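import Literature.MathematicalPhysics.QuantumFieldTheory.Balaban1983to89.B2Eq265GaugedLipschitz

/-!
# `Balaban1983to89.B2Eq265ConstantPart` — [Balaban1982Higgs2] Lemma 2.4 proof p.572 «From the property (2.60) we have the inequality
# |A^{(k)}(x) − A^{(k)}(y)| ≦ O(p(Lᵏε)r(Lᵏε)). Let us denote by A₀ a constant configuration equal to A^{(k)}(y) at each point, thus
# A^{(k)} − A₀ = O(p(Lᵏε)r(Lᵏε))» ON THE (Higgs)₂,₃ CARRIER: the constant part `A₀` of the background on `□` and the bound on
# `A′ = A − A₀` DERIVED from the small-gradient form of the regularity of `A` on `□`; hence **(2.65) with the hypotheses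
# (A₀, s, |A − A₀| ≤ s) ELIMINATED** (`eq265_higgs_region_reg`)

statement-level skeleton of published theorems with citation tags; proofs where landed; nothing here is a claim
about the Yang–Mills mass gap

PDF held: `paper:balaban1982-cmp86-higgs23-ii` (journal page = PDF page + 554), p. 572 [PDF 18] (text layer p0018 L11–15).

CITATION HEADER (lean-in-tree rule).  T. Bałaban, *(Higgs)₂,₃ quantum fields in a finite volume. II. An upper bound*,
Commun. Math. Phys. **86** (1982) 555–594, doi:10.1007/bf01214890 [Balaban1982Higgs2].  Cell `lit-balaban` (HOME
`run/shared/lean/pub/lit-balaban/`), Phase-2 proof seat **p23** gen 21 (unit `lit-balaban-p23-g21`; free-target protocol G.5-34(d), TAKING #7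
line HOME/STATUS.md 2026-08-23); SKELETON row **B2.Lem2.4** (fold owner r02, second reader r14; head `proved p250408 · …` UNCHANGED —
cells-only member, brick F7 of the seat's programme).  USED BY NAME, never restated: own F6 `B2Eq265GaugedLipschitz.{eq265_higgs_region_cov,
lipschitz_of_bond_bound}` (p352507; the telescoping lemma is used at level `k = 0`), the typer's `B2Eq255Concrete.{underRegion, mem_underRegion}`, `HiggsAveraging.{blockIter, toFinest}`, p15's
`B2Ineq329ZeroAveraging.{val_blockIter, sitesPerDir_zero_eq}`, `B2Ineq329PrismHolonomy.val_toFinest`.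

THE ARGUMENT.  When `□₂` IS a box `q + [0,S)ᵈ` of coarse sites, `□ = B^k(□₂)` is the fine box `q̄ + [0,LᵏS)ᵈ`
(`mem_underRegion_iff_offsets`, from the exact label identity `n_ν(z − q̄) = Lᵏ·n_ν(z_k − q) + (n_ν(z) mod Lᵏ)`).  The small-gradient
form `|A_{⟨z+e_ν,μ⟩} − A_{⟨z,μ⟩}| ≤ δA` on `□` (the hypothesis F4′/F5 already carry for the kernel rows; print's «property (2.60)»)
telescopes along lattice paths inside that box (F6's `lipschitz_of_bond_bound` at level 0, `2LᵏS ≤ |T_ε|_μ`) to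
`|A_b − A_{⟨q̄, dir b⟩}| ≤ δA·d·LᵏS` on every bond `b` of `□`: print's «A^{(k)} − A₀ = O(p(Lᵏε)r(Lᵏε))» with `A₀ :=` the constant
configuration equal to `A` at the corner `q̄` (print: at `y`).  Feeding `c := A(q̄, ·)` and `s := δA·d·LᵏS` to F6's `eq265_higgs_region_cov`
removes the constant field and the size `s` from the hypotheses of (2.65).

WHAT THIS FILE PROVES (kernel-checked, zero `sorry`; theorems only — NO definition, NO `Prop`-valued fact; axioms standard).
 §1 (this file) `val_sub_toFinest_eq` (the label identity), **`mem_underRegion_iff_offsets`** (`B^k(q + [0,S)ᵈ) = q̄ + [0,LᵏS)ᵈ`).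
 §2 **`abs_sub_corner_le_of_grad`** — «A^{(k)} − A₀ = O(·)»: `|A_b − A_{⟨q̄, dir b⟩}| ≤ δA·d·LᵏS` on the bonds of `□`.
 §3 **`eq265_higgs_region_reg`** — (2.65) value clause on the carrier with `A₀ := A(q̄,·)`, `s := δA·d·LᵏS` built in: hypotheses =
    geometry, the (I.2.23) regularity of `A` on `B^k(Λ₂)` ((2.67)), the small-gradient form `δA` on `□`, `|φ| ≤ t′` on `Λ₆`, the covariant
    per-bond bound `λ_A` at `Ā^{(k)}` on `□₁`, and `ρ`.

HONEST SCOPE / DIFFERENCES FROM PRINT (recorded, not hidden; one sentence each).  (a) BASE POINT: `A₀` is `A` at the corner `q̄` of `□`,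
print takes the value at the centre `y` — any base point of `□` serves (the constant changes by nothing print tracks).  (b) NO-WRAP BINDERS:
F6's `LᵏS < |T_ε|_μ` is KEPT and the binder `2·LᵏS ≤ |T_ε|_μ` is ADDED (the level-0 telescoping `lipschitz_of_bond_bound` needs the fine box
to be smaller than half the torus so that in-box coordinate differences are torus distances), and `□₂` must now BE the box `q + [0,S)ᵈ`
(F6: `□₂ ⊆` it; `B^k(□₂) =` a cell box is still asked); print's `□` is far smaller than the torus either way.  (c) READINGS NOT DERIVED:
`s = δA·d·LᵏS` is print's `O(p(Lᵏε)r(Lᵏε))` only after the readings `LᵏδA ⇐ (2.60)` «(∂^η_μA^{(k)})(x) = O(p(Lᵏε))» — row B2.Lem2.3, whose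
tree statement `B2Lemma23Torus.lemma23Printed_torus` lives on the `famTorus23` family, NOT on this carrier, so `δA` is NOT fed by name (no
bridge in the tree) — and `S ⇐` the `□₂` radius `4r(Lᵏε)` (geometry); both are the user's.  (d) Everything else as in F6's HONEST SCOPE
(value clause only; `λ_A` = `ℓ ×` (2.55)₃'s quantity at `Ā^{(k)}`, `t′`, `ρ`, box shape not derived).  NOT summit progress.
-/

open scoped BigOperators

noncomputable section

namespace Literature.MathematicalPhysics.QuantumFieldTheory.Balaban1983to89.B2Eq265ConstantPart

open HiggsLattice (ChargeData)
open HiggsAveraging (blockIter toFinest)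
open HiggsCovariance (avgQkAdj)
open HiggsCovariancePos (Inside)
open B2Eq255Concrete (bgScalar256 underRegion mem_underRegion barA)
open B2Eq265GaugedLipschitz (eq265_higgs_region_cov lipschitz_of_bond_bound)
open B2Ineq329ZeroAveraging (val_blockIter sitesPerDir_zero_eq)
open B2Ineq329PrismHolonomy (val_toFinest)
open B1Ineq225RegularBox (cellBox)
open B1Ineq234Concrete (distC)
open B1TorusRegionHSizes (IsBigBlockUnion)
open B1TorusCubeCover (half)
open B1TorusCubeLocality26 (rS)

variable {P : HiggsLattice.Params} {N : ℕ} {k : ℕ}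

/-! ## §1 `B^k` of a box of coarse sites is a box of fine sites -/

section Box

/-- **THE LABEL IDENTITY**: `n_ν(z − q̄) = Lᵏ·n_ν(z_k − q) + (n_ν(z) mod Lᵏ)` — the fine offset of `z` from the corner `q̄` is `Lᵏ`
times the coarse offset of its block point plus the position of `z` in its block. [cite: Balaban1982Higgs1, (1.19)–(1.20) p.607] -/
theorem val_sub_toFinest_eq (hk : k ≤ P.K) (q : HiggsLattice.Site P k) (z : HiggsLattice.Site P 0) (ν : Fin P.d) :
    (z ν - toFinest q ν).val = P.L ^ k * ((blockIter k z) ν - q ν).val + (z ν).val % P.L ^ k := by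
  have hn := sitesPerDir_zero_eq (P := P) hk ν
  have hLk : 0 < P.L ^ k := pow_pos P.hL k
  set t := ((blockIter k z) ν - q ν).val with ht
  set r := (z ν).val % P.L ^ k with hr
  have hB : ((blockIter k z) ν).val = (z ν).val / P.L ^ k := val_blockIter hk z ν
  have hbq : ((blockIter k z) ν).val ≡ (q ν).val + t [MOD P.sitesPerDir k ν] := by
    have e : (blockIter k z) ν = q ν + ((blockIter k z) ν - q ν) := by ring
    have := congrArg ZMod.val e
    rw [ZMod.val_add] at this
    rw [this, ht]
    exact Nat.mod_modEq _ _
  have hZ : (z ν).val = P.L ^ k * ((z ν).val / P.L ^ k) + r := (Nat.div_add_mod _ _).symm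
  have hmain' : (z ν).val ≡ (q ν).val * P.L ^ k + (P.L ^ k * t + r) [MOD P.L ^ k * P.sitesPerDir k ν] := by
    have h := Nat.ModEq.mul_left' (P.L ^ k) hbq
    rw [hB] at h
    have h2 := Nat.ModEq.add_right r h
    calc (z ν).val = P.L ^ k * ((z ν).val / P.L ^ k) + r := hZ
      _ ≡ P.L ^ k * ((q ν).val + t) + r [MOD P.L ^ k * P.sitesPerDir k ν] := h2
      _ = (q ν).val * P.L ^ k + (P.L ^ k * t + r) := by ring
  have hmain : (z ν).val ≡ (q ν).val * P.L ^ k + (P.L ^ k * t + r) [MOD P.sitesPerDir 0 ν] := by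
    have key : ∀ m : ℕ, m = P.L ^ k * P.sitesPerDir k ν →
        ((z ν).val ≡ (q ν).val * P.L ^ k + (P.L ^ k * t + r) [MOD m]) := by
      intro m hm; subst hm; exact hmain'
    exact key _ hn
  have hdiff : z ν - toFinest q ν = ((P.L ^ k * t + r : ℕ) : ZMod (P.sitesPerDir 0 ν)) := by
    rw [← ZMod.natCast_zmod_val (z ν), ← ZMod.natCast_zmod_val (toFinest q ν), val_toFinest hk q ν, sub_eq_iff_eq_add,
      ← Nat.cast_add, ZMod.natCast_eq_natCast_iff, add_comm]
    exact hmain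
  have hlt : P.L ^ k * t + r < P.sitesPerDir 0 ν := by
    have htn : t + 1 ≤ P.sitesPerDir k ν := Nat.succ_le_of_lt (ZMod.val_lt _)
    have hrL : r < P.L ^ k := Nat.mod_lt _ hLk
    calc P.L ^ k * t + r < P.L ^ k * t + P.L ^ k := by omega
      _ = P.L ^ k * (t + 1) := by ring
      _ ≤ P.L ^ k * P.sitesPerDir k ν := Nat.mul_le_mul_left _ htn
      _ = P.sitesPerDir 0 ν := hn.symm
  rw [hdiff, ZMod.val_natCast, Nat.mod_eq_of_lt hlt]

/-- **`B^k(q + [0,S)ᵈ) = q̄ + [0,LᵏS)ᵈ`**: when `□₂` IS the box of coarse sites with offsets `< S` from `q`, a fine site lies in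
`□ = B^k(□₂)` iff its offsets from `q̄` are `< LᵏS`. [cite: Balaban1982Higgs2, Lemma 2.4 proof p.572 «□ = B^k(□₂)»]
[cite: Balaban1982Higgs1, (1.19)–(1.20) p.607] -/
theorem mem_underRegion_iff_offsets (hk : k ≤ P.K) (q : HiggsLattice.Site P k) (Sbox : ℕ) (sq₂ : Finset (HiggsLattice.Site P k))
    (hsq₂ : ∀ y : HiggsLattice.Site P k, y ∈ sq₂ ↔ ∀ ν : Fin P.d, (y ν - q ν).val < Sbox) (z : HiggsLattice.Site P 0) :
    z ∈ underRegion k sq₂ ↔ ∀ ν : Fin P.d, (z ν - toFinest q ν).val < P.L ^ k * Sbox := by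
  have hLk : 0 < P.L ^ k := pow_pos P.hL k
  rw [mem_underRegion, hsq₂]
  refine forall_congr' fun ν => ?_
  rw [val_sub_toFinest_eq hk q z ν]
  have hr : (z ν).val % P.L ^ k < P.L ^ k := Nat.mod_lt _ hLk
  set t := ((blockIter k z) ν - q ν).val
  set r := (z ν).val % P.L ^ k
  constructor
  · intro h
    calc P.L ^ k * t + r < P.L ^ k * t + P.L ^ k := by omega
      _ = P.L ^ k * (t + 1) := by ring
      _ ≤ P.L ^ k * Sbox := Nat.mul_le_mul_left _ (Nat.succ_le_of_lt h)
  · intro h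
    have h1 : P.L ^ k * t < P.L ^ k * Sbox := lt_of_le_of_lt (Nat.le_add_right _ _) h
    exact Nat.lt_of_mul_lt_mul_left h1

end Box

/-! ## §2 «A^{(k)} − A₀ = O(p(Lᵏε)r(Lᵏε))» from the small-gradient form on `□` -/

section ConstantPart

/-- **«Let us denote by A₀ a constant configuration equal to A^{(k)}(·) at (a) point, thus A^{(k)} − A₀ = O(p(Lᵏε)r(Lᵏε))»** — on the
carrier: if `□₂` IS the box `q + [0,S)ᵈ` (`2LᵏS ≤ |T_ε|_μ`) and `|A_{⟨z+e_ν, μ⟩} − A_{⟨z, μ⟩}| ≤ δA` for `z ∈ □ = B^k(□₂)`, then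
`|A_b − A_{⟨q̄, dir b⟩}| ≤ δA·d·LᵏS` for every bond `b` of `□` (telescoping along lattice paths inside the fine box, F6's
`lipschitz_of_bond_bound` at level 0; base point = the corner `q̄`). [cite: Balaban1982Higgs2, Lemma 2.4 proof p.572 «From the property (2.60) we have the inequality |A^{(k)}(x) − A^{(k)}(y)| ≦ O(p(Lᵏε)r(Lᵏε)). Let us denote by A₀ a constant configuration equal to A^{(k)}(y) at each point, thus A^{(k)} − A₀ = O(p(Lᵏε)r(Lᵏε))»] -/
theorem abs_sub_corner_le_of_grad (hk : k ≤ P.K) (q : HiggsLattice.Site P k) (Sbox : ℕ) (sq₂ : Finset (HiggsLattice.Site P k))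
    (hsq₂ : ∀ y : HiggsLattice.Site P k, y ∈ sq₂ ↔ ∀ ν : Fin P.d, (y ν - q ν).val < Sbox)
    (h2 : ∀ μ : Fin P.d, 2 * (P.L ^ k * Sbox) ≤ P.sitesPerDir 0 μ) (A : HiggsLattice.VecField P 0) {δA : ℝ}
    (hreg : ∀ z ∈ underRegion k sq₂, ∀ μ ν : Fin P.d, |A ⟨z.shift ν, μ⟩ - A ⟨z, μ⟩| ≤ δA)
    (b : HiggsLattice.PBond P 0) (hb : Inside (underRegion k sq₂) b) :
    |A b - A ⟨toFinest q, b.dir⟩| ≤ δA * (P.d * ((P.L : ℝ) ^ k * Sbox)) := by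
  have hmem := mem_underRegion_iff_offsets hk q Sbox sq₂ hsq₂
  have hsrc : ∀ ν : Fin P.d, (b.src ν - toFinest q ν).val < P.L ^ k * Sbox := (hmem b.src).mp hb.1
  have hcorner : ∀ ν : Fin P.d, (toFinest q ν - toFinest q ν).val < P.L ^ k * Sbox := by
    intro ν; rw [sub_self, ZMod.val_zero]; have := hsrc ν; omega
  -- the per-bond bound for `ψ = A(·, μ)` on the fine box
  have hbnd : ∀ (y : HiggsLattice.Site P 0) (ν : Fin P.d), (∀ ν', (y ν' - toFinest q ν').val < P.L ^ k * Sbox) →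
      (∀ ν', ((y.shift ν) ν' - toFinest q ν').val < P.L ^ k * Sbox) →
      ‖(fun z : HiggsLattice.Site P 0 => A ⟨z, b.dir⟩) (y.shift ν) - (fun z : HiggsLattice.Site P 0 => A ⟨z, b.dir⟩) y‖ ≤ δA := by
    intro y ν hy _
    rw [Real.norm_eq_abs]
    exact hreg y ((hmem y).mpr hy) b.dir ν
  have hlip := lipschitz_of_bond_bound (toFinest q) (P.L ^ k * Sbox) h2 (fun z : HiggsLattice.Site P 0 => A ⟨z, b.dir⟩) hbnd _
    b.src (toFinest q) hsrc hcorner rfl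
  have hδ : 0 ≤ δA := le_trans (abs_nonneg _) (hreg b.src hb.1 b.dir b.dir)
  have hsum : (∑ μ : Fin P.d, Nat.dist (b.src μ - toFinest q μ).val (toFinest q μ - toFinest q μ).val : ℕ)
      ≤ P.d * (P.L ^ k * Sbox) := by
    calc ∑ μ : Fin P.d, Nat.dist (b.src μ - toFinest q μ).val (toFinest q μ - toFinest q μ).val
        ≤ ∑ _μ : Fin P.d, P.L ^ k * Sbox := Finset.sum_le_sum fun μ _ => by
          rw [sub_self, ZMod.val_zero, Nat.dist_zero_right]; exact (hsrc μ).le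
      _ = P.d * (P.L ^ k * Sbox) := by rw [Finset.sum_const, Finset.card_univ, Fintype.card_fin, smul_eq_mul]
  have hsum' : ((∑ μ : Fin P.d, Nat.dist (b.src μ - toFinest q μ).val (toFinest q μ - toFinest q μ).val : ℕ) : ℝ)
      ≤ (P.d : ℝ) * ((P.L : ℝ) ^ k * Sbox) := by exact_mod_cast hsum
  have e : A b = A ⟨b.src, b.dir⟩ := rfl
  rw [e, ← Real.norm_eq_abs]
  exact hlip.trans (mul_le_mul_of_nonneg_left hsum' hδ)

end ConstantPart

/-! ## §3 (2.65) with the constant part built in -/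

section Eq265Reg

/-- **LEMMA 2.4 (2.65), VALUE CLAUSE, ON THE (Higgs)₂,₃ CARRIER — the constant field `A₀` and the size `s` ELIMINATED.**  TYPED vs
PRINTED: this is F6's `B2Eq265GaugedLipschitz.eq265_higgs_region_cov` word for word with the binders `c`, `s` and the hypothesis
`|A_b − c_{dir b}| ≤ s` on the inside bonds of `□` ELIMINATED — `c ↦ A(q̄, ·)` (the value of `A` at the corner of `□`), `s ↦ δA·d·LᵏS` in
every one of its occurrences in the bound (`abs_sub_corner_le_of_grad`) — and two located binder edits: `□₂` IS the box `q + [0,S)ᵈ` of coarse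
sites (`∀ y, y ∈ □₂ ↔ n_ν(y − q) < S`, replacing `□₂ ⊆` it) and `2LᵏS ≤ |T_ε|_μ` is added.  The remaining hypotheses: the geometry, the
(I.2.23) regularity of `A` on `B^k(Λ₂)`, its small-gradient form `δA` on `□` (print's «property (2.60)», a READING of row B2.Lem2.3 not
fed by name), `|φ| ≤ t′` on `Λ₆`, the covariant per-bond bound `λ_A` at `Ā^{(k)}` on the bonds of `□₁` («restrictions (2.55)»), and
`ρ ≤ dist(ȳ, T^{(k)} ∖ □₁)`. [cite: Balaban1982Higgs2, Lemma 2.4 (2.65) p.572]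
[cite: Balaban1982Higgs2, Lemma 2.4 proof p.572 «From the property (2.60) we have the inequality |A^{(k)}(x) − A^{(k)}(y)| ≦ O(p(Lᵏε)r(Lᵏε)). Let us denote by A₀ a constant configuration equal to A^{(k)}(y) at each point, thus A^{(k)} − A₀ = O(p(Lᵏε)r(Lᵏε))»] -/
theorem eq265_higgs_region_reg (d L : ℕ) (hd : 1 ≤ d) (hL : 2 ≤ L) {a : ℝ} (ha : 0 < a) {msq : ℝ} (hmsq : 0 < msq)
    (N : ℕ) (C : ChargeData N) (ε₀ : ℝ) (creg β : ℝ) (hcreg : 0 ≤ creg) (hβ : 0 < β) :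
    ∃ K₀min : ℕ, ∀ K₀ : ℕ, K₀min ≤ K₀ → ∃ e₁ t : ℝ, 0 < e₁ ∧ 0 < t ∧
      ∃ C₁ C₂ C₃ D₁ D₂ D₃ D₄ : ℝ, 0 ≤ C₁ ∧ 0 ≤ C₂ ∧ 0 ≤ C₃ ∧ 0 ≤ D₁ ∧ 0 ≤ D₂ ∧ 0 ≤ D₃ ∧ 0 ≤ D₄ ∧
      ∀ (P : HiggsLattice.Params), P.d = d → P.L = L → K₀ ∣ P.M →
      ∀ {k : ℕ}, 1 ≤ k → k ≤ P.K → (∀ μ, 3 * half P k K₀ ≤ P.sitesPerDir 0 μ) → P.mesh k ≤ ε₀ → P.mesh k ≤ 1 →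
      ∀ (Λ₂ Λ₆ sq₂ sq₁ : Finset (HiggsLattice.Site P k)) (S : Fin P.d → Finset ℕ) (q : HiggsLattice.Site P k) (Sbox : ℕ),
        Λ₆ ⊆ Λ₂ → sq₂ ⊆ Λ₂ → sq₁ ⊆ sq₂ → sq₁ ⊆ Λ₆ →
        IsBigBlockUnion k K₀ (underRegion k Λ₂) → underRegion k sq₂ = cellBox k K₀ S →
        (∀ μ : Fin P.d, P.L ^ k * Sbox < P.sitesPerDir 0 μ) →
      -- `□₂` IS the box `q + [0,S)ᵈ` of coarse sites, `□ = B^k(□₂)` smaller than half the torus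
        (∀ y : HiggsLattice.Site P k, y ∈ sq₂ ↔ ∀ ν : Fin P.d, (y ν - q ν).val < Sbox) →
        (∀ μ : Fin P.d, 2 * (P.L ^ k * Sbox) ≤ P.sitesPerDir 0 μ) →
      -- `□₁` is a box of coarse sites, smaller than half the torus
      ∀ (q₁ : HiggsLattice.Site P k) (S₁ : ℕ), (∀ μ : Fin P.d, 2 * S₁ ≤ P.sitesPerDir k μ) →
        (∀ y : HiggsLattice.Site P k, y ∈ sq₁ ↔ ∀ ν : Fin P.d, (y ν - q₁ ν).val < S₁) →
      ∀ (A : HiggsLattice.VecField P 0) {ec : ℝ}, 0 < ec → ec ≤ e₁ →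
        (∀ z ∈ underRegion k Λ₂, ∀ μ ν : Fin P.d,
            P.mesh k * |C.e| / ec * |A ⟨z.shift μ, ν⟩ - A ⟨z, ν⟩| ≤ creg * ec ^ (β - 1) / (P.L : ℝ) ^ k) →
        ∀ {δA : ℝ}, 0 ≤ δA →
          (∀ z ∈ underRegion k sq₂, ∀ μ ν : Fin P.d, |A ⟨z.shift ν, μ⟩ - A ⟨z, μ⟩| ≤ δA) →
          (P.L : ℝ) ^ k * δA * |C.e| ≤ t →
      ∀ (x : HiggsLattice.Site P 0),
        (∀ z, HiggsLattice.Site.tdist x z ≤ 2 * rS P k K₀ + 2 * half P k K₀ * (P.d + 1) + 1 → z ∈ underRegion k sq₂) →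
        blockIter k x ∈ sq₁ →
      ∀ (φ : HiggsLattice.ScalarField P k N) {t' : ℝ}, 0 ≤ t' → (∀ y ∈ Λ₆, ‖φ y‖ ≤ t') →
        -- the (2.55)₃-type covariant per-bond bound at `Ā^{(k)}` on the bonds of `□₁`
        ∀ {lamA : ℝ}, 0 ≤ lamA →
          (∀ (y : HiggsLattice.Site P k) (μ : Fin P.d), y ∈ sq₁ → y.shift μ ∈ sq₁ →
            ‖C.U (P.mesh k) (barA k A ⟨y, μ⟩) (φ (y.shift μ)) - φ y‖ ≤ lamA) →
        ∀ {ρ : ℝ}, (∀ y : HiggsLattice.Site P k, y ∉ sq₁ → ρ ≤ (HiggsLattice.Site.tdist (blockIter k x) y : ℝ)) →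
        ‖bgScalar256 C msq a k Λ₂ Λ₆ A φ x - avgQkAdj C A k φ x‖
          ≤ B1.aSeq a P.L k * t' *
                (C₁ * Real.exp (-(1 / (4 * K₀) * (distC (underRegion k sq₂) x / (P.L : ℝ) ^ k)))
                  + C₂ * Real.exp (-(1 / (4 * K₀) * ρ)))
            + (D₁ * P.mesh k ^ 2 *
                (B1.aSeq a P.L k * (P.mesh k)⁻¹ ^ 2 * (|C.e| * (δA * (P.d * ((P.L : ℝ) ^ k * Sbox))) * P.mesh 0 * (P.d * ((P.L : ℝ) ^ k - 1))) * t'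
                  + |C.e| * (δA * (P.d * ((P.L : ℝ) ^ k * Sbox))) * (P.d * ((B1.aSeq a P.L k * (P.mesh k)⁻¹ ^ 2 * t' * D₄ * P.mesh k
                        + |C.e| * (δA * (P.d * ((P.L : ℝ) ^ k * Sbox))) * (B1.aSeq a P.L k * D₃ * t')) + |C.e| * (δA * (P.d * ((P.L : ℝ) ^ k * Sbox))) * (B1.aSeq a P.L k * D₃ * t')))
                  + B1.aSeq a P.L k * (P.mesh k)⁻¹ ^ 2 *
                      ((2 * (|C.e| * (δA * (P.d * ((P.L : ℝ) ^ k * Sbox))) * P.mesh 0 * (P.d * ((P.L : ℝ) ^ k - 1)))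
                        + (|C.e| * (δA * (P.d * ((P.L : ℝ) ^ k * Sbox))) * P.mesh 0 * (P.d * ((P.L : ℝ) ^ k - 1))) ^ 2) * (B1.aSeq a P.L k * D₃ * t')))
              + D₂ * P.mesh k * (|C.e| * (δA * (P.d * ((P.L : ℝ) ^ k * Sbox))) * (B1.aSeq a P.L k * D₃ * t')))
            + B1.aSeq a P.L k * C₃ *
                (4 * K₀ * ((lamA + P.mesh k * |C.e| * (δA * (P.d * ((P.L : ℝ) ^ k * Sbox))) * t') * P.d) + Real.exp (-(1 / (4 * K₀) * ρ)) * t')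
            + msq * P.mesh k ^ 2 / (B1.aSeq a P.L k + msq * P.mesh k ^ 2) * t'
            + |C.e| * P.mesh 0 * (P.d * ((P.L : ℝ) ^ k - 1)) * (δA * (P.d * ((P.L : ℝ) ^ k * Sbox))) * t' := by
  obtain ⟨K₀min, h⟩ := eq265_higgs_region_cov d L hd hL ha hmsq N C ε₀ creg β hcreg hβ
  refine ⟨K₀min, fun K₀ hK₀ => ?_⟩
  obtain ⟨e₁, t, he₁, ht, C₁, C₂, C₃, D₁, D₂, D₃, D₄, hC₁, hC₂, hC₃, hD₁, hD₂, hD₃, hD₄, h⟩ := h K₀ hK₀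
  refine ⟨e₁, t, he₁, ht, C₁, C₂, C₃, D₁, D₂, D₃, D₄, hC₁, hC₂, hC₃, hD₁, hD₂, hD₃, hD₄, ?_⟩
  intro P hPd hPL hK₀M k hk1 hkK h3 hε h1 Λ₂ Λ₆ sq₂ sq₁ S q Sbox h62 hs2 h12 h16 hΩΛ hbox hSbox hsq₂ h2S q₁ S₁ hS₁ hsq₁ A ec hec
    hle hreg δA hδA hregbox ht' x hx hxsq φ t' ht0 hφ lamA hlamA hcovA ρ hρ
  have hq : ∀ y ∈ sq₂, ∀ μ : Fin P.d, (y μ - q μ).val < Sbox := fun y hy => (hsq₂ y).mp hy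
  have hs : (0 : ℝ) ≤ δA * (P.d * ((P.L : ℝ) ^ k * Sbox)) := by positivity
  have hAc : ∀ b : HiggsLattice.PBond P 0, Inside (underRegion k sq₂) b →
      |A b - (fun μ : Fin P.d => A ⟨toFinest q, μ⟩) b.dir| ≤ δA * (P.d * ((P.L : ℝ) ^ k * Sbox)) :=
    fun b hb => abs_sub_corner_le_of_grad hkK q Sbox sq₂ hsq₂ h2S A hregbox b hb
  have hmain := h P hPd hPL hK₀M hk1 hkK h3 hε h1 Λ₂ Λ₆ sq₂ sq₁ S q Sbox h62 hs2 h12 h16 hΩΛ hbox hSbox hq q₁ S₁ hS₁ hsq₁ A hec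
    hle hreg hδA hregbox ht' (fun μ : Fin P.d => A ⟨toFinest q, μ⟩) hs hAc x hx hxsq φ ht0 hφ hlamA hcovA hρ
  rw [hPd] at hmain ⊢
  exact hmain

end Eq265Reg

end Literature.MathematicalPhysics.QuantumFieldTheory.Balaban1983to89.B2Eq265ConstantPart

end
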